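import Literature.NumberTheory.Rogawski1990.LevelOnePieceDepthOneStrataValuesRamified   -- ★ p846992 (this seat): §B `redMat_placeForm_mul_depthOne_eq_transpose_mul_of_ramified` (the depth-1 residue is `J̄`-symmetric); brings ★ p846899∕p846857∕p846957, `redMat`, `ValBound`
import Literature.NumberTheory.Automorphic.UnitaryDepthZeroPieceOrbitalIntegral              -- ★ O8b FILE 3 (inert model): `redMat_sub_one_pow_eq_zero_of_deep`, `rank_lt_of_isNilpotent`, `redMat_coe_mul_redMat_coe_inv`, `rank_redMat_conj_sub_one_eq`; brings ★ `classOrbitalIntegral_eq_smul_sum_ncard_strata`, `isRegularElt_val_conj`, `isClosed_conjClass_local_of_isRegularElt`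
import Literature.NumberTheory.Automorphic.UnitaryLatticeTreeCharpolyCongruence             -- ★ `v_inv_mul_charpoly_coeff_sub_le_one` (`A ≡ B mod c ⇒ χ_A ≡ χ_B mod c`)
import Literature.NumberTheory.Automorphic.ResidualMoebiusShiftRank                         -- ★ `pow_card_redMat_eq_zero_of_charpoly_eq` (Cayley–Hamilton on the reduction)
import HarnessLib

/-!
# «(O8b)-ram», A-file: THE GUARDS OF A `v`-DEEP CLASS at a tame-ramified non-split place — every conjugate `x⁻¹tx ∈ K′` of a `v`-deep `t` is residually unipotent of Jordan rank
# `≠ 1`, its depth-1 residue is nilpotent on the interior, and `x` is the (R1) witness — so the two-layer (U)-ram head (★ p846963 + ★ p846992) applies on `K′ ∩ ⟦t⟧` with no extra hypothesis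

Topic `NumberTheory/Automorphic`; namespace `Literature.NumberTheory.Automorphic.UnitaryGroup`.  THEOREMS ONLY (no definition, no instance, no notation, no named fact, no `sorry`).
Hand F0P3a-p05 (g16), 2026-09-01.  Cell `pub/hodgecm-mathlib`, crux H413 = `stmt-HodgeConjecture-24833`; road «S3-ram» seeding wave (LEAD F0P3a-plan (g12) T11-41∕T11-72; owner∕table
F0P3a-p06 (g15) v1.6); A-file of the tame-ramified, TWO-LAYER twin of the inert ★ O8b FILE 3 `classOrbitalIntegral_eq_mul_strata_three_of_deep` (B-file
`UnitaryLevelOnePieceOrbitalIntegralRamified`: the six-strata orbital integral).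

THE MATHEMATICS ([Rogawski1990] §4.9 pp. 54–55; [Kottwitz1986] §3; [Laumon1995] (5.3.2)).  `L` CM, `v` finite non-split TAME-RAMIFIED in `L` (`w ∣ v`, `2 ∈ 𝒪_w^×`), `G′_v = U(H′)(L⁺_v)`
with hyperspecial `K′ = U(H′)(𝒪_v)`, residual form `J̄ = red H′_w = c̄ • ᵗĀ J₀ Ā`.  A `v`-LEVEL-1 piece `g ∈ C_c^∞(G′_v)` (supported in `K′`, `Ad K′`-invariant, left-invariant under
`K(ϖ_v) = K_w(2)`) takes SIX values on the part of `K′` that meets `v`-deep classes (the two-layer (U)-ram head): `c 2` on the boundary stratum (`rank(red x_w − 1) = 2`; RIGID-2-ram),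
and on the interior `x_w ≡ 1 (ϖ)` the values `c′ 0 ∣ c′ 2 ∣ c₁ 1, c₁ ε` according to the `O(J̄)`-orbit of the depth-1 residue `N(x) = red(ϖ⁻¹(x_w − 1)) ∈ 𝔭(J̄)` (rank `0 ∣ 2 ∣ 1`, the
rank-1 orbits split by the square class of the values of `z ↦ zᵀ(J̄N(x))z`).  For `t ∈ G′_v` REGULAR with compact centraliser and `v`-DEEP (`t_w ≡ 1 (ϖ_v)`, i.e. `w`-2-deep — A-p16
(g31) 22:24:50Z: «the clause's `V` must be 2-deep») every conjugate `x = q⁻¹tq ∈ K′` satisfies the head's guards AUTOMATICALLY (§2: `(red x_w − 1)³ = 0` and, on the interior,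
`N(x)³ = 0` by `χ_{ϖ⁻¹(x_w−1)} = χ_{ϖ⁻¹(t_w−1)} ≡ T³`; `rank(red x_w − 1) ≠ 1` — no transvections in `O₃`; the `v`-deep witness `y := q`), so ★ `classOrbitalIntegral_eq_smul_sum_ncard_strata`
with the six-valued stratum reader gives
  **`Φ(⟦t⟧, g) = ν(K′) · (c 2·n_bd(t) + c′ 0·n_0(t) + c′ 2·n_reg(t) + c₁ 1·n_{1,□}(t) + c₁ ε·n_{1,¬□}(t))`**,
the counts over `q ∈ Fix_t(G′_v ⧸ K′)` with `x := q.out⁻¹ t q.out` (§3).  On `n_{1,¬□}` every non-zero value of the residual form is `a²ε` (★ `exists_eq_sq_or_eq_sq_mul_of_not_isSquare`,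
F0P3-p03 (g14)); a non-zero value exists by polarisation (§1).  This is the `G`-side of the `_le_one`-ram clauses per piece: the clause hands (e1)(e2) now only need CLOSED FORMS for the
six counts at the literals (CERT P1ram-T0, B-p14 (g38) ∕ A-p16 (g31): strata `bd, 0, reg, 1±`), and for a one-stratum indicator piece it is A-p12 (g23)'s «five-strata linearity».
HONEST LABEL: HC_CM is proved only modulo the 2 remaining named inputs (hLiu418 24832, h413 24833) until rung 0 closes; unconditional local algebra ∕ measure bookkeeping, no books consequence.

## References
* [Rogawski1990] J. D. Rogawski, *Automorphic Representations of Unitary Groups in Three Variables*, Ann. of Math. Stud. 123 (1990): §4.9 pp. 54–55, Prop. 4.9.1; §3.9 p. 32.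
* [Kottwitz1986] R. E. Kottwitz, *Base change for unit elements of Hecke algebras*, Compositio Math. 60 (1986): §3 (congruence filtration; fixed points on the building).
* [Laumon1995] G. Laumon, *Cohomology of Drinfeld Modular Varieties* I (1996): Lemma (5.3.2) p. 136 (orbital integrals as weighted fixed-point counts).
* [BruhatTits1972] F. Bruhat, J. Tits, *Groupes réductifs sur un corps local* I, Publ. Math. IHÉS 41 (1972): §10 (graded layers of parahorics).
-/

set_option autoImplicit false

noncomputable section

open MeasureTheory Measure Set Filter Topology NumberField IsDedekindDomain Matrix ValuativeRel
open Literature.NumberTheory.Rogawski1990 Literature.NumberTheory.GaloisRepresentations Literature.NumberTheory.Automorphic.UnitaryGroup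
open Literature.NumberTheory.Automorphic.IntegralReduction Literature.GroupTheory.SpecificGroups Literature.NumberTheory.Automorphic.UnitaryLatticeTree
open scoped Matrix MatrixGroups ValuativeRel

namespace Literature.NumberTheory.Automorphic.UnitaryGroup

/-! ## §1 Residue-field algebra: polarisation; no rank-`1` unipotents in `O(J̄)` at a residual frame -/

section Generic

variable {K : Type*} [Field K]

/-- **POLARISATION**: a non-zero SYMMETRIC matrix over a field with `2 ≠ 0` has a non-zero diagonal value `zᵀ S z ≠ 0` (else `2·S i j = (eᵢ+eⱼ)ᵀS(eᵢ+eⱼ) − eᵢᵀSeᵢ − eⱼᵀSeⱼ = 0`).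
[cite: CollingwoodMcGovern1993, §9.3] -/
theorem exists_dotProduct_mulVec_ne_zero_of_transpose_eq (h2 : (2 : K) ≠ 0) {n : ℕ} {S : Matrix (Fin n) (Fin n) K} (hS : Sᵀ = S) (hne : S ≠ 0) :
    ∃ z : Fin n → K, z ⬝ᵥ (S *ᵥ z) ≠ 0 := by
  classical
  by_contra h
  have h' : ∀ z : Fin n → K, z ⬝ᵥ (S *ᵥ z) = 0 := fun z => not_ne_iff.1 fun hz => h ⟨z, hz⟩
  have hij : ∀ i j, (Pi.single i (1 : K)) ⬝ᵥ (S *ᵥ (Pi.single j (1 : K))) = S i j := fun i j => by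
    simp [Matrix.mulVec_single, single_dotProduct]
  have hsymm : ∀ i j, S j i = S i j := fun i j => by rw [← Matrix.transpose_apply S i j, hS]
  have hdiag : ∀ i, S i i = 0 := fun i => by have := h' (Pi.single i 1); rwa [hij] at this
  apply hne
  ext i j
  have hpol := h' (Pi.single i 1 + Pi.single j 1)
  rw [Matrix.mulVec_add, dotProduct_add, add_dotProduct, add_dotProduct, hij, hij, hij, hij, hdiag, hdiag, hsymm i j] at hpol
  have h2S : (2 : K) * S i j = 0 := by linear_combination hpol
  rw [Matrix.zero_apply]
  exact (mul_eq_zero.1 h2S).resolve_left h2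

/-- **NO TRANSVECTIONS IN `O(J̄)` at a residual frame**: for `J̄ = c • Āᵀ J₀ Ā` (`c ≠ 0`, `σ'` pointwise the identity, `2 ≠ 0`) and a unipotent `u ∈ U(σ', J̄)`, `rank(u − 1) ≠ 1`
(transport `u ↦ ĀuĀ⁻¹ ∈ O(J₀)` and ★ `rank_sub_one_ne_one_of_mem_orthogonal`, F0P3-p03 (g14)). [cite: Rogawski1990, §3.9 p. 32] -/
theorem rank_sub_one_ne_one_of_mem_unitaryGroupOfForm_residueFrame (h2 : (2 : K) ≠ 0) {σ' : K →+* K} (hσ' : ∀ x, σ' x = x) (Ab : GL (Fin 3) K)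
    {c : K} (hc : c ≠ 0) {Jb : Matrix (Fin 3) (Fin 3) K} (hJb : Jb = c • formCongr σ' Ab ((StdForm.antidiagonal 3).over K)) {u : GL (Fin 3) K}
    (hu : u ∈ unitaryGroupOfForm σ' Jb) (hnil : IsNilpotent ((u : Matrix (Fin 3) (Fin 3) K) - 1)) :
    ((u : Matrix (Fin 3) (Fin 3) K) - 1).rank ≠ 1 := by
  obtain rfl : σ' = RingHom.id K := RingHom.ext hσ'
  subst hJb
  have hto : Ab * u * Ab⁻¹ ∈ unitaryGroupOfForm (RingHom.id K) ((StdForm.antidiagonal 3).over K) :=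
    conj_mem_unitaryGroupOfForm (RingHom.id K) Ab _ ((mem_unitaryGroupOfForm_smul_iff (RingHom.id K) _ hc u).1 hu)
  have hconjsub : ((Ab * u * Ab⁻¹ : GL (Fin 3) K) : Matrix (Fin 3) (Fin 3) K) - 1 =
      (Ab : Matrix (Fin 3) (Fin 3) K) * ((u : Matrix (Fin 3) (Fin 3) K) - 1) * ((Ab⁻¹ : GL (Fin 3) K) : Matrix (Fin 3) (Fin 3) K) := by
    rw [Matrix.mul_sub, Matrix.sub_mul, Matrix.mul_one, Units.val_mul, Units.val_mul, Units.mul_inv]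
  have hnilc : IsNilpotent (((Ab * u * Ab⁻¹ : GL (Fin 3) K) : Matrix (Fin 3) (Fin 3) K) - 1) := by
    obtain ⟨m, hm⟩ := hnil
    exact ⟨m, by rw [hconjsub, Units.conj_pow, hm, Matrix.mul_zero, Matrix.zero_mul]⟩
  have hrankc : ((((Ab * u * Ab⁻¹ : GL (Fin 3) K) : Matrix (Fin 3) (Fin 3) K) - 1)).rank = ((u : Matrix (Fin 3) (Fin 3) K) - 1).rank := by
    rw [hconjsub, Matrix.rank_mul_eq_left_of_isUnit_det _ _ (Matrix.isUnits_det_units Ab⁻¹),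
      Matrix.rank_mul_eq_right_of_isUnit_det _ _ (Matrix.isUnits_det_units Ab)]
  rw [← hrankc]
  exact rank_sub_one_ne_one_of_mem_orthogonal h2 hto hnilc

end Generic

/-! ## §2 The guards of the two-layer head hold AUTOMATICALLY on a `v`-deep class -/

section Guards

set_option maxHeartbeats 1600000 in
-- budget only: statement-heavy CM-place tokens; no search tactic runs long here.
/-- **GUARDS OF A `v`-DEEP CLASS.**  Let `t ∈ G′_v` be `v`-DEEP (`t_w ≡ 1 (ϖ_v)`, token `(ι_w ϖ_v)^1`, = `w`-2-deep) and `x⁻¹ t x ∈ K′`.  Then for `k := x⁻¹ t x`: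
(G1) `(red k_w − 1)³ = 0` (deep characteristic polynomial, ★ `redMat_sub_one_pow_eq_zero_of_deep`); (G2) `rank(red k_w − 1) ≠ 1` (`red k_w ∈ O(J̄)`, no transvections in `O₃`,
§1 at the residual frame `J̄ = red(−det H′_w) • ᵗĀ J₀ Ā` of ★ `exists_residueFrame_of_integralFrame`); (G3) if `rank(red k_w − 1) = 0` then `k_w ≡ 1 (ϖ)` (★ ROW-0) and the depth-1
residue `N(k) = red(ϖ⁻¹(k_w − 1))` is NILPOTENT: `χ(ϖ⁻¹(k_w − 1)) = χ(ϖ⁻¹(t_w − 1))` (conjugate by `x_w`) and `ϖ⁻¹(t_w − 1) ≡ 0 (ϖ)`, so `χ(N(k)) = T³` (★ `pow_card_redMat_eq_zero_of_charpoly_eq`);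
(G4) the (R1) witness: `(x k x⁻¹)_w = t_w ≡ 1 (ϖ_v)`.  [cite: Kottwitz1986, §3] [cite: Rogawski1990, §4.9 p. 54; §3.9 p. 32] -/
theorem guards_of_conj_mem_of_vDeep_ramified
    (L : Type) [Field L] [NumberField L] [IsCMField L] (H' : Matrix (Fin 3) (Fin 3) L)
    {v : HeightOneSpectrum (𝓞 ↥(maximalRealSubfield L))}
    (w : PlacesOver L v)
    (hw : IsCMField.complexConj L • w.1 = w.1) (he : v.asIdeal.ramificationIdx' w.1.asIdeal ≠ 1)
    (hH'w : IsUnit (placeForm H' w.1)) (hH'i : hH'w.unit ∈ glInt 3 (w.1.adicCompletion L))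
    (h2 : IsUnit (2 : 𝒪[(w.1.adicCompletion L)]))
    (ϖ : (w.1.adicCompletion L)) (hϖ : Valued.v ϖ = WithZero.exp (-1 : ℤ))
    (A : GL (Fin 3) (w.1.adicCompletion L)) (hA : A ∈ glInt 3 (w.1.adicCompletion L))
    (hframe : (placeForm H' w.1) = (-(placeForm H' w.1).det) • formCongr (galAdicCompletionMap (L := L) (IsCMField.complexConj L) hw) A ((StdForm.antidiagonal 3).over (w.1.adicCompletion L)))
    (t : ((cmDatum L 3 H').Local v)) (htdeep : (∀ a b, Valued.v (((toPlace v w (HeckeCharacter.uniformizer ↥(maximalRealSubfield L) v : v.adicCompletion ↥(maximalRealSubfield L))) ^ 1)⁻¹ * ((((t).val : GL (Fin 3) (UnitaryGroup.LocalRing L v)).val.map (Pi.evalRingHom (fun w' : PlacesOver L v => w'.1.adicCompletion L) w)) a b - (1 : Matrix (Fin 3) (Fin 3) (w.1.adicCompletion L)) a b)) ≤ 1))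
    (x : ((cmDatum L 3 H').Local v)) (hx : x⁻¹ * t * x ∈ (cmLocalIntegralLevel L 3 H' v)) :
    ((redMat (((((x⁻¹ * t * x)).val : GL (Fin 3) (UnitaryGroup.LocalRing L v)).val.map (Pi.evalRingHom (fun w' : PlacesOver L v => w'.1.adicCompletion L) w))) - 1).rank ≠ 1 ∧ (redMat (((((x⁻¹ * t * x)).val : GL (Fin 3) (UnitaryGroup.LocalRing L v)).val.map (Pi.evalRingHom (fun w' : PlacesOver L v => w'.1.adicCompletion L) w))) - 1) ^ 3 = 0) ∧
    ((redMat (((((x⁻¹ * t * x)).val : GL (Fin 3) (UnitaryGroup.LocalRing L v)).val.map (Pi.evalRingHom (fun w' : PlacesOver L v => w'.1.adicCompletion L) w))) - 1).rank = 0 → (∀ a b, Valued.v (ϖ⁻¹ * (((((x⁻¹ * t * x)).val : GL (Fin 3) (UnitaryGroup.LocalRing L v)).val.map (Pi.evalRingHom (fun w' : PlacesOver L v => w'.1.adicCompletion L) w)) a b - (1 : Matrix (Fin 3) (Fin 3) (w.1.adicCompletion L)) a b)) ≤ 1) ∧ (redMat (ϖ⁻¹ • (((((x⁻¹ * t * x)).val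 : GL (Fin 3) (UnitaryGroup.LocalRing L v)).val.map (Pi.evalRingHom (fun w' : PlacesOver L v => w'.1.adicCompletion L) w)) - 1))) ^ 3 = 0) ∧
    (∃ y : ((cmDatum L 3 H').Local v), (∀ a b, Valued.v (((toPlace v w (HeckeCharacter.uniformizer ↥(maximalRealSubfield L) v : v.adicCompletion ↥(maximalRealSubfield L))) ^ 1)⁻¹ * (((((localNonsplitEquiv (IsCMField.complexConj L) H' (IsCMField.complexConj_ne_one L) w hw (y * (x⁻¹ * t * x) * y⁻¹)) : ↥(unitaryGroupOfForm (galAdicCompletionMap (L := L) (IsCMField.complexConj L) hw) (placeForm H' w.1))) : GL (Fin 3) (w.1.adicCompletion L)) : Matrix (Fin 3) (Fin 3) (w.1.adicCompletion L)) a b - (1 : Matrix (Fin 3) (Fin 3) (w.1.adicCompletion L)) a b)) ≤ 1)) := by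
  classical
  have hc1 : IsCMField.complexConj L ≠ 1 := IsCMField.complexConj_ne_one L
  -- §0 place facts
  have hσO : ∀ z : 𝒪[(w.1.adicCompletion L)], (galAdicCompletionMap (L := L) (IsCMField.complexConj L) hw) z ∈ 𝒪[(w.1.adicCompletion L)] := mem_integer_galAdicCompletionMap (IsCMField.complexConj L) v w hw
  obtain ⟨σk, hσk⟩ := exists_residueField_ringHom_galAdicCompletionMap (IsCMField.complexConj L) v w hw
  have hidx : ∀ y, σk y = y := residueHom_galAdicCompletionMap_eq_self_of_ramified (IsCMField.complexConj L) v hc1 w hw he σk hσO hσk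
  have hid : σk = RingHom.id _ := RingHom.ext hidx
  subst hid
  have h2k : (2 : 𝓀[(w.1.adicCompletion L)]) ≠ 0 := by
    have h := h2.map (IsLocalRing.residue 𝒪[(w.1.adicCompletion L)])
    rw [map_ofNat] at h
    exact h.ne_zero
  have hϖu : IsUniformizingElement ϖ := isUniformizingElement_of_v_eq hϖ
  have hϖne : ϖ ≠ 0 := fun h0 => by rw [h0, map_zero] at hϖ; exact WithZero.coe_ne_zero hϖ.symm
  have hval1 : ∀ {z : (w.1.adicCompletion L)}, Valued.v z ≤ 1 → valuation (w.1.adicCompletion L) z ≤ 1 := fun {z} hz => by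
    have h := (v_le_iff_valuation_le z 1).1 (by rwa [map_one]); rwa [map_one] at h
  have hval2 : ∀ {z : (w.1.adicCompletion L)}, valuation (w.1.adicCompletion L) z ≤ 1 → Valued.v z ≤ 1 := fun {z} hz => by
    have h' := (v_le_iff_valuation_le z 1).2 (by rwa [map_one]); rwa [map_one] at h'
  -- the level scalar `P = ι_w(ϖ_v)`: `|P|_w = exp(−2) = |ϖ|²`
  set P : (w.1.adicCompletion L) := (toPlace v w (HeckeCharacter.uniformizer ↥(maximalRealSubfield L) v : v.adicCompletion ↥(maximalRealSubfield L))) with hPdef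
  have hP : Valued.v P = WithZero.exp (-2 : ℤ) := (valued_toPlace_uniformizer_of_ramified L (IsCMField.complexConj L) hc1 w hw he).1
  have hϖ2 : Valued.v (ϖ ^ 2) = WithZero.exp (-2 : ℤ) := by rw [map_pow, hϖ, ← WithZero.exp_nsmul]; norm_num
  have hPϖ : Valued.v P = Valued.v ϖ * Valued.v ϖ := by rw [hP, ← hϖ2, map_pow, pow_two]
  have hP1 : Valued.v P < 1 := by rw [hP, ← WithZero.exp_zero]; exact WithZero.exp_lt_exp.2 (by norm_num)
  have hPne : P ≠ 0 := fun h0 => by rw [h0, map_zero] at hP; exact WithZero.coe_ne_zero hP.symm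
  have hϖ1 : Valued.v ϖ < 1 := by rw [hϖ, ← WithZero.exp_zero]; exact WithZero.exp_lt_exp.2 (by norm_num)
  -- §1 the matrices of `t`, `x`, `k = x⁻¹ t x` in the one-place model
  have hkI : (((localNonsplitEquiv (IsCMField.complexConj L) H' (IsCMField.complexConj_ne_one L) w hw (x⁻¹ * t * x)) : ↥(unitaryGroupOfForm (galAdicCompletionMap (L := L) (IsCMField.complexConj L) hw) (placeForm H' w.1))) : GL (Fin 3) (w.1.adicCompletion L)) ∈ glInt 3 (w.1.adicCompletion L) := (mem_localIntegralLevel_iff_of_smul_eq (IsCMField.complexConj L) 3 H' hc1 w hw (x⁻¹ * t * x)).1 hx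
  obtain ⟨Mt, hMt⟩ : ∃ M : Matrix (Fin 3) (Fin 3) (w.1.adicCompletion L), M = ((((localNonsplitEquiv (IsCMField.complexConj L) H' (IsCMField.complexConj_ne_one L) w hw t) : ↥(unitaryGroupOfForm (galAdicCompletionMap (L := L) (IsCMField.complexConj L) hw) (placeForm H' w.1))) : GL (Fin 3) (w.1.adicCompletion L)) : Matrix (Fin 3) (Fin 3) (w.1.adicCompletion L)) := ⟨_, rfl⟩
  obtain ⟨Mx, hMx⟩ : ∃ M : Matrix (Fin 3) (Fin 3) (w.1.adicCompletion L), M = ((((localNonsplitEquiv (IsCMField.complexConj L) H' (IsCMField.complexConj_ne_one L) w hw x) : ↥(unitaryGroupOfForm (galAdicCompletionMap (L := L) (IsCMField.complexConj L) hw) (placeForm H' w.1))) : GL (Fin 3) (w.1.adicCompletion L)) : Matrix (Fin 3) (Fin 3) (w.1.adicCompletion L)) := ⟨_, rfl⟩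
  obtain ⟨Mxi, hMxi⟩ : ∃ M : Matrix (Fin 3) (Fin 3) (w.1.adicCompletion L), M = (((((localNonsplitEquiv (IsCMField.complexConj L) H' (IsCMField.complexConj_ne_one L) w hw x)⁻¹ : ↥(unitaryGroupOfForm (galAdicCompletionMap (L := L) (IsCMField.complexConj L) hw) (placeForm H' w.1)))) : GL (Fin 3) (w.1.adicCompletion L)) : Matrix (Fin 3) (Fin 3) (w.1.adicCompletion L)) := ⟨_, rfl⟩
  obtain ⟨Mk, hMk⟩ : ∃ M : Matrix (Fin 3) (Fin 3) (w.1.adicCompletion L), M = ((((localNonsplitEquiv (IsCMField.complexConj L) H' (IsCMField.complexConj_ne_one L) w hw (x⁻¹ * t * x)) : ↥(unitaryGroupOfForm (galAdicCompletionMap (L := L) (IsCMField.complexConj L) hw) (placeForm H' w.1))) : GL (Fin 3) (w.1.adicCompletion L)) : Matrix (Fin 3) (Fin 3) (w.1.adicCompletion L)) := ⟨_, rfl⟩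
  have hMtspell : (((t).val : GL (Fin 3) (UnitaryGroup.LocalRing L v)).val.map (Pi.evalRingHom (fun w' : PlacesOver L v => w'.1.adicCompletion L) w)) = Mt := by rw [hMt]; exact (coe_localNonsplitEquiv_apply L H' v w hw t).symm
  have hMkspell : ((((x⁻¹ * t * x)).val : GL (Fin 3) (UnitaryGroup.LocalRing L v)).val.map (Pi.evalRingHom (fun w' : PlacesOver L v => w'.1.adicCompletion L) w)) = Mk := by rw [hMk]; exact (coe_localNonsplitEquiv_apply L H' v w hw (x⁻¹ * t * x)).symm
  have hxix : Mxi * Mx = 1 := by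
    rw [hMxi, hMx, Subgroup.coe_inv, ← Units.val_mul, inv_mul_cancel, Units.val_one]
  have hxxi : Mx * Mxi = 1 := by
    rw [hMxi, hMx, Subgroup.coe_inv, ← Units.val_mul, mul_inv_cancel, Units.val_one]
  have hMkprod : Mk = Mxi * Mt * Mx := by
    have he : (localNonsplitEquiv (IsCMField.complexConj L) H' (IsCMField.complexConj_ne_one L) w hw) (x⁻¹ * t * x) =
        (localNonsplitEquiv (IsCMField.complexConj L) H' (IsCMField.complexConj_ne_one L) w hw x)⁻¹ *
          (localNonsplitEquiv (IsCMField.complexConj L) H' (IsCMField.complexConj_ne_one L) w hw) t *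
          (localNonsplitEquiv (IsCMField.complexConj L) H' (IsCMField.complexConj_ne_one L) w hw) x := by
      have h1 : (localNonsplitEquiv (IsCMField.complexConj L) H' (IsCMField.complexConj_ne_one L) w hw) (x⁻¹ * t * x) =
          (localNonsplitEquiv (IsCMField.complexConj L) H' (IsCMField.complexConj_ne_one L) w hw) (x⁻¹ * t) *
            (localNonsplitEquiv (IsCMField.complexConj L) H' (IsCMField.complexConj_ne_one L) w hw) x := map_mul _ _ _
      have h2 : (localNonsplitEquiv (IsCMField.complexConj L) H' (IsCMField.complexConj_ne_one L) w hw) (x⁻¹ * t) =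
          (localNonsplitEquiv (IsCMField.complexConj L) H' (IsCMField.complexConj_ne_one L) w hw) x⁻¹ *
            (localNonsplitEquiv (IsCMField.complexConj L) H' (IsCMField.complexConj_ne_one L) w hw) t := map_mul _ _ _
      have h3 : (localNonsplitEquiv (IsCMField.complexConj L) H' (IsCMField.complexConj_ne_one L) w hw) x⁻¹ =
          ((localNonsplitEquiv (IsCMField.complexConj L) H' (IsCMField.complexConj_ne_one L) w hw) x)⁻¹ := map_inv _ _
      rw [h1, h2, h3]
    rw [hMk, he, hMxi, hMt, hMx, Subgroup.coe_mul, Subgroup.coe_mul, Units.val_mul, Units.val_mul]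
  -- `t` is `v`-deep: `D := P⁻¹ • (t_w − 1)` is integral
  have hDint0 : IsIntMatrix (P⁻¹ • ((((t).val : GL (Fin 3) (UnitaryGroup.LocalRing L v)).val.map (Pi.evalRingHom (fun w' : PlacesOver L v => w'.1.adicCompletion L) w)) - 1)) := fun a b => by
    rw [Matrix.smul_apply, smul_eq_mul, Matrix.sub_apply]
    have h := htdeep a b
    rwa [pow_one] at h
  have hDint : IsIntMatrix (P⁻¹ • (Mt - 1)) := by rw [← hMtspell]; exact hDint0
  -- §2 (G1): deep characteristic polynomial of `t_w`, then ★ `redMat_sub_one_pow_eq_zero_of_deep`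
  have ht : ∀ m : ℕ, valuation (w.1.adicCompletion L) ((((((t).val : GL (Fin 3) (UnitaryGroup.LocalRing L v)).val.map (Pi.evalRingHom (fun w' : PlacesOver L v => w'.1.adicCompletion L) w))).charpoly - (Polynomial.X - 1) ^ 3).coeff m) < 1 := by
    intro m
    have h1int : IsIntMatrix (1 : Matrix (Fin 3) (Fin 3) (w.1.adicCompletion L)) := fun a b => by
      rw [Matrix.one_apply]; split_ifs <;> simp
    have hc := v_inv_mul_charpoly_coeff_sub_le_one h1int hP1.le hDint0 m
    rw [Matrix.charpoly_one, Fintype.card_fin] at hc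
    rw [Polynomial.coeff_sub]
    refine (v_lt_one_iff_valuation_lt_one _).1 ?_
    have hmul : Valued.v (((((t).val : GL (Fin 3) (UnitaryGroup.LocalRing L v)).val.map (Pi.evalRingHom (fun w' : PlacesOver L v => w'.1.adicCompletion L) w))).charpoly.coeff m - ((Polynomial.X - 1) ^ 3 : Polynomial (w.1.adicCompletion L)).coeff m) =
        Valued.v P * Valued.v (P⁻¹ * (((((t).val : GL (Fin 3) (UnitaryGroup.LocalRing L v)).val.map (Pi.evalRingHom (fun w' : PlacesOver L v => w'.1.adicCompletion L) w))).charpoly.coeff m - ((Polynomial.X - 1) ^ 3 : Polynomial (w.1.adicCompletion L)).coeff m)) := by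
      rw [← map_mul, ← mul_assoc, mul_inv_cancel₀ hPne, one_mul]
    rw [hmul]
    calc Valued.v P * _ ≤ Valued.v P * 1 := by gcongr
      _ < 1 := by rw [mul_one]; exact hP1
  have hG1 : (redMat (((((x⁻¹ * t * x)).val : GL (Fin 3) (UnitaryGroup.LocalRing L v)).val.map (Pi.evalRingHom (fun w' : PlacesOver L v => w'.1.adicCompletion L) w))) - 1) ^ 3 = 0 := redMat_sub_one_pow_eq_zero_of_deep L 3 H' v w hw t ht x hx
  -- §3 (G2): `red k_w ∈ O(J̄)` is unipotent, hence of Jordan rank `≠ 1` (no transvections in `O₃`), through the residual frame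
  have hJint : ∀ i j, (placeForm H' w.1) i j ∈ 𝒪[(w.1.adicCompletion L)] := fun i j => ((mem_glInt_iff _).1 hH'i).1 i j
  have hJinv : ∀ i j, (((hH'w.unit⁻¹ : (Matrix (Fin 3) (Fin 3) (w.1.adicCompletion L))ˣ) : Matrix (Fin 3) (Fin 3) (w.1.adicCompletion L))) i j ∈ 𝒪[(w.1.adicCompletion L)] :=
    fun i j => ((mem_glInt_iff _).1 hH'i).2 i j
  let JO : Matrix (Fin 3) (Fin 3) 𝒪[(w.1.adicCompletion L)] := Matrix.of fun i j => ⟨(placeForm H' w.1) i j, hJint i j⟩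
  have hJ : (placeForm H' w.1) = JO.map ((↑) : 𝒪[(w.1.adicCompletion L)] → (w.1.adicCompletion L)) := by ext i j; rfl
  have hinjO : Function.Injective (fun M : Matrix (Fin 3) (Fin 3) 𝒪[(w.1.adicCompletion L)] => M.map ((↑) : 𝒪[(w.1.adicCompletion L)] → (w.1.adicCompletion L))) :=
    Matrix.map_injective Subtype.val_injective
  have hJOdet : IsUnit JO.det := by
    let JI : Matrix (Fin 3) (Fin 3) 𝒪[(w.1.adicCompletion L)] :=
      Matrix.of fun i j => ⟨(((hH'w.unit⁻¹ : (Matrix (Fin 3) (Fin 3) (w.1.adicCompletion L))ˣ) : Matrix (Fin 3) (Fin 3) (w.1.adicCompletion L))) i j, hJinv i j⟩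
    have hJI : (((hH'w.unit⁻¹ : (Matrix (Fin 3) (Fin 3) (w.1.adicCompletion L))ˣ) : Matrix (Fin 3) (Fin 3) (w.1.adicCompletion L))) = JI.map ((↑) : 𝒪[(w.1.adicCompletion L)] → (w.1.adicCompletion L)) := by
      ext i j; rfl
    have hmul : JO * JI = 1 := by
      apply hinjO
      change (JO * JI).map ⇑(𝒪[(w.1.adicCompletion L)]).subtype = (1 : Matrix (Fin 3) (Fin 3) 𝒪[(w.1.adicCompletion L)]).map ⇑(𝒪[(w.1.adicCompletion L)]).subtype
      rw [Matrix.map_mul, Matrix.map_one (𝒪[(w.1.adicCompletion L)]).subtype (map_zero _) (map_one _)]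
      change JO.map ((↑) : 𝒪[(w.1.adicCompletion L)] → (w.1.adicCompletion L)) * JI.map ((↑) : 𝒪[(w.1.adicCompletion L)] → (w.1.adicCompletion L)) = 1
      rw [← hJ, ← hJI]
      have hmi := hH'w.unit.mul_inv
      rw [hH'w.unit_spec] at hmi
      exact hmi
    exact Matrix.isUnit_det_of_right_inverse hmul
  have hJred : redMat (placeForm H' w.1) = JO.map (IsLocalRing.residue 𝒪[(w.1.adicCompletion L)]) := by
    rw [hJ]; exact redMat_mapMatrix JO
  clear_value JO
  have hcO : (((-JO.det : 𝒪[(w.1.adicCompletion L)])) : (w.1.adicCompletion L)) = -((placeForm H' w.1)).det := by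
    rw [Subring.coe_neg, hJ]; exact congrArg Neg.neg (RingHom.map_det (𝒪[(w.1.adicCompletion L)]).subtype JO).symm
  obtain ⟨Ab, hAb⟩ := exists_residueFrame_of_integralFrame (galAdicCompletionMap (L := L) (IsCMField.complexConj L) hw) (RingHom.id 𝓀[(w.1.adicCompletion L)]) hσO hσk (placeForm H' w.1) JO hJ A hA (-JO.det) hcO hframe
  have hcb : IsLocalRing.residue 𝒪[(w.1.adicCompletion L)] (-JO.det) ≠ 0 := by
    rw [map_neg, neg_ne_zero]
    exact (hJOdet.map _).ne_zero
  have hJb : redMat (placeForm H' w.1) = IsLocalRing.residue 𝒪[(w.1.adicCompletion L)] (-JO.det) • formCongr (RingHom.id 𝓀[(w.1.adicCompletion L)]) Ab ((StdForm.antidiagonal 3).over 𝓀[(w.1.adicCompletion L)]) := by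
    rw [hJred]; exact hAb
  -- the unit `red k_w` of `GL₃(𝓀_w)` and its membership in `O(J̄)` (unitarity reduced, `σ̄_w = id`)
  have hJvb : ValBound 1 (placeForm H' w.1) := fun i j => (Valuation.mem_integer_iff _ _).1 (hJint i j)
  have hMkint : ValBound 1 Mk := by rw [hMk]; exact valBound_one_of_mem_glInt hkI
  let u : GL (Fin 3) 𝓀[(w.1.adicCompletion L)] := ⟨redMat Mk, redMat ((((((((localNonsplitEquiv (IsCMField.complexConj L) H' (IsCMField.complexConj_ne_one L) w hw (x⁻¹ * t * x)) : ↥(unitaryGroupOfForm (galAdicCompletionMap (L := L) (IsCMField.complexConj L) hw) (placeForm H' w.1))) : GL (Fin 3) (w.1.adicCompletion L)))⁻¹ : GL (Fin 3) (w.1.adicCompletion L))) : Matrix (Fin 3) (Fin 3) (w.1.adicCompletion L))),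
    by rw [hMk]; exact redMat_coe_mul_redMat_coe_inv hkI, by rw [hMk]; exact redMat_coe_inv_mul_redMat_coe hkI⟩
  have hu1 : ((u : GL (Fin 3) 𝓀[(w.1.adicCompletion L)]) : Matrix (Fin 3) (Fin 3) 𝓀[(w.1.adicCompletion L)]) = redMat Mk := rfl
  have hu : u ∈ unitaryGroupOfForm (RingHom.id 𝓀[(w.1.adicCompletion L)]) (redMat (placeForm H' w.1)) := by
    rw [mem_unitaryGroupOfForm_iff, hu1]
    have hU : (Mk.map (galAdicCompletionMap (L := L) (IsCMField.complexConj L) hw))ᵀ * (placeForm H' w.1) * Mk = (placeForm H' w.1) := by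
      have h := mem_unitaryGroupOfForm_iff.1 (localNonsplitEquiv (IsCMField.complexConj L) H' hc1 w hw (x⁻¹ * t * x)).2
      rwa [← hMk] at h
    have hσint : ValBound 1 (Mk.map (galAdicCompletionMap (L := L) (IsCMField.complexConj L) hw)) := fun a b => by
      rw [Matrix.map_apply]
      exact (Valuation.mem_integer_iff _ _).1 (red_galAdicCompletionMap_eq_of_ramified L v w hw he ((Valuation.mem_integer_iff _ _).2 (hMkint a b))).1
    have hσT : ValBound 1 (Mk.map (galAdicCompletionMap (L := L) (IsCMField.complexConj L) hw))ᵀ := IntegralReduction.ValBound.transpose' hσint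
    have hσTJ : ValBound 1 ((Mk.map (galAdicCompletionMap (L := L) (IsCMField.complexConj L) hw))ᵀ * (placeForm H' w.1)) := by have h := hσT.mul hJvb; rwa [one_mul] at h
    have hred := congrArg redMat hU
    rw [redMat_mul hσTJ hMkint, redMat_mul hσT hJvb, redMat_transpose,
      redMat_map_galAdicCompletionMap_eq_of_ramified L v w hw he (fun i j => (Valuation.mem_integer_iff _ _).2 (hMkint i j))] at hred
    rw [map_ringHom_id_eq]
    exact hred
  have hG2 : (redMat (((((x⁻¹ * t * x)).val : GL (Fin 3) (UnitaryGroup.LocalRing L v)).val.map (Pi.evalRingHom (fun w' : PlacesOver L v => w'.1.adicCompletion L) w))) - 1).rank ≠ 1 := by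
    have hnilu : IsNilpotent (((u : GL (Fin 3) 𝓀[(w.1.adicCompletion L)]) : Matrix (Fin 3) (Fin 3) 𝓀[(w.1.adicCompletion L)]) - 1) := by
      rw [hu1, ← hMkspell]; exact ⟨3, hG1⟩
    have h := rank_sub_one_ne_one_of_mem_unitaryGroupOfForm_residueFrame h2k (fun _ => rfl) Ab hcb hJb hu hnilu
    rw [hu1] at h
    rwa [hMkspell]
  refine ⟨⟨hG2, hG1⟩, fun hr0 => ?_, ⟨x, fun a b => ?_⟩⟩
  · -- §4 (G3): `k_w ≡ 1 (ϖ)` from rank `0` (★ ROW-0), and `N(k)³ = 0` by the characteristic polynomial of the conjugate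
    have hle : ∀ i j, valuation (w.1.adicCompletion L) ((Mk - 1) i j) ≤ valuation (w.1.adicCompletion L) ϖ := by
      have h := (rank_redMat_sub_one_eq_zero_iff_forall_valuation_le (n := 3) hϖu hkI).1 (by rw [← hMk, ← hMkspell]; exact hr0)
      intro i j; have hij := h i j; rwa [← hMk] at hij
    have hint : (∀ a b, Valued.v (ϖ⁻¹ * (((((x⁻¹ * t * x)).val : GL (Fin 3) (UnitaryGroup.LocalRing L v)).val.map (Pi.evalRingHom (fun w' : PlacesOver L v => w'.1.adicCompletion L) w)) a b - (1 : Matrix (Fin 3) (Fin 3) (w.1.adicCompletion L)) a b)) ≤ 1) := fun a b => by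
      rw [hMkspell, ← Matrix.sub_apply]
      have hv : Valued.v ((Mk - 1) a b) ≤ Valued.v ϖ := (v_le_iff_valuation_le _ _).2 (hle a b)
      rw [map_mul, map_inv₀]
      calc (Valued.v ϖ)⁻¹ * Valued.v ((Mk - 1) a b) ≤ (Valued.v ϖ)⁻¹ * Valued.v ϖ := by gcongr
        _ = 1 := inv_mul_cancel₀ (by rw [hϖ]; exact WithZero.coe_ne_zero)
    refine ⟨hint, ?_⟩
    have hAint : ValBound 1 (ϖ⁻¹ • (Mk - 1)) := fun a b => by
      rw [Matrix.smul_apply, smul_eq_mul, Matrix.sub_apply]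
      have h := hint a b
      rw [hMkspell] at h
      exact hval1 h
    -- `W := ϖ⁻¹ • (Mt − 1)` has entries of valuation `≤ |ϖ| < 1`
    have hvϖne : Valued.v ϖ ≠ 0 := by rw [hϖ]; exact WithZero.coe_ne_zero
    have hWv : ∀ a b, Valued.v ((ϖ⁻¹ • (Mt - 1)) a b) ≤ Valued.v ϖ := fun a b => by
      have hd : Valued.v (P⁻¹ * (Mt - 1) a b) ≤ 1 := by have h := hDint a b; rwa [Matrix.smul_apply, smul_eq_mul] at h
      have hdv : Valued.v ((Mt - 1) a b) ≤ Valued.v ϖ * Valued.v ϖ := by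
        have hsplit : (Mt - 1) a b = P * (P⁻¹ * (Mt - 1) a b) := by rw [← mul_assoc, mul_inv_cancel₀ hPne, one_mul]
        rw [hsplit, map_mul, hPϖ]
        exact mul_le_of_le_one_right' hd
      rw [Matrix.smul_apply, smul_eq_mul, map_mul, map_inv₀]
      calc (Valued.v ϖ)⁻¹ * Valued.v ((Mt - 1) a b) ≤ (Valued.v ϖ)⁻¹ * (Valued.v ϖ * Valued.v ϖ) := by gcongr
        _ = Valued.v ϖ := by rw [← mul_assoc, inv_mul_cancel₀ hvϖne, one_mul]
    have hWint : ValBound 1 (ϖ⁻¹ • (Mt - 1)) := fun a b => hval1 ((hWv a b).trans hϖ1.le)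
    have hWlt : ∀ a b, valuation (w.1.adicCompletion L) ((ϖ⁻¹ • (Mt - 1)) a b) < 1 := fun a b =>
      (v_lt_one_iff_valuation_lt_one _).1 ((hWv a b).trans_lt hϖ1)
    have hconj : ϖ⁻¹ • (Mk - 1) = (((((localNonsplitEquiv (IsCMField.complexConj L) H' (IsCMField.complexConj_ne_one L) w hw x) : ↥(unitaryGroupOfForm (galAdicCompletionMap (L := L) (IsCMField.complexConj L) hw) (placeForm H' w.1))) : GL (Fin 3) (w.1.adicCompletion L))).val)⁻¹ * (ϖ⁻¹ • (Mt - 1)) * ((((localNonsplitEquiv (IsCMField.complexConj L) H' (IsCMField.complexConj_ne_one L) w hw x) : ↥(unitaryGroupOfForm (galAdicCompletionMap (L := L) (IsCMField.complexConj L) hw) (placeForm H' w.1))) : GL (Fin 3) (w.1.adicCompletion L))).val := by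
      have hvi : (((((localNonsplitEquiv (IsCMField.complexConj L) H' (IsCMField.complexConj_ne_one L) w hw x) : ↥(unitaryGroupOfForm (galAdicCompletionMap (L := L) (IsCMField.complexConj L) hw) (placeForm H' w.1))) : GL (Fin 3) (w.1.adicCompletion L))).val)⁻¹ = Mxi := by
        rw [hMxi, Subgroup.coe_inv, Matrix.coe_units_inv]
      have hv : ((((localNonsplitEquiv (IsCMField.complexConj L) H' (IsCMField.complexConj_ne_one L) w hw x) : ↥(unitaryGroupOfForm (galAdicCompletionMap (L := L) (IsCMField.complexConj L) hw) (placeForm H' w.1))) : GL (Fin 3) (w.1.adicCompletion L))).val = Mx := hMx.symm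
      rw [hvi, hv, hMkprod, Matrix.mul_smul, Matrix.smul_mul, Matrix.mul_sub, Matrix.sub_mul, Matrix.mul_one, hxix]
    have hchar : (ϖ⁻¹ • (Mk - 1)).charpoly = (ϖ⁻¹ • (Mt - 1)).charpoly := by
      rw [hconj]; exact Matrix.charpoly_units_conj' _ _
    have h3 := pow_card_redMat_eq_zero_of_charpoly_eq hAint hWint hWlt hchar
    rwa [← hMkspell] at h3
  · -- §5 (G4): the `v`-deep witness `y := x`
    have hxe : x * (x⁻¹ * t * x) * x⁻¹ = t := by group
    rw [hxe, coe_localNonsplitEquiv_apply L H' v w hw t]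
    exact htdeep a b

end Guards

end Literature.NumberTheory.Automorphic.UnitaryGroup

end
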